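import Summits.QuantumAdvantage.QuantumAdvantage.Theorems.CharDialSegmentMovesG
import Summits.QuantumAdvantage.QuantumAdvantage.Theorems.DigitDialD
import HarnessLib

/-!
# CharDial — segment moves, part H: the Young ladder's kernel floor, by name from the DigitDial lineage

Support for `CharDial.WalkHardFJLinOdd` (stmt-QuantumAdvantage-32604), continuing part G.  The Young slice of the blocker (part G: forms =
scalar × ONE class indicator of an assignment `π : Fin n → Fin B`, `B ≈ n/(8p log₂ n)` classes at the comb schedule) has a DECIDED floor in
another lineage of the tree: `Theorems.DigitDial.spreadLinM_card_win_le` (item OddPrimeWalk 23109) — strategies reading `K ≤ (log₂ n)^C`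
linear forms mod `M ≤ (log₂ n)^C` (`3 ∤ M`) through arbitrary tables, every non-trivial combination of the forms having support
`≥ (log₂ n)^{4C+6}`, win the u-walk game on `≤ (7/8)·2ⁿ` inputs.  Class indicators of `B ≤ (log₂ n)^C` classes each of size `≥ (log₂ n)^{4C+6}`
are such forms, so: `youngSideInfo_floor` (junta-free tables of ALL class popcounts mod `p` lose, `θ = 7/8`) and `youngForms_floor`
(junta-free Young data over such assignments lose), both by name.  The top of the ladder (the slice at `B ≈ n/(8p log₂ n)` with juntas
`≤ log₂ n`) is not decided here or anywhere in the tree; nothing about it is claimed.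
-/

set_option autoImplicit false

namespace Summit.QuantumAdvantage.AdviceFreeQNC0.JLinPeel.SegMove

open Finset
open Summit.QuantumAdvantage.AdviceFreeQNC0
open Summit.QuantumAdvantage.QuantumAdvantage.Theorems

variable {n : ℕ} {p : ℕ}

/-- **kernel floor of the side-information attack form (junta-free), by name.**  For `n ≥ 16`, a prime `5 ≤ p ≤ (log₂ n)^C`, an
assignment with `B ≤ (log₂ n)^C` classes each of size `≥ (log₂ n)^{4C+6}`, and ANY junta-free tables of the class popcounts mod `p`, the
strategy wins on `≤ (7/8)·2ⁿ` inputs — `DigitDial.spreadLinM_card_win_le` at the class-indicator forms. -/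
theorem youngSideInfo_floor (C : ℕ) (hn : 16 ≤ n) (c : ℕ) [hp : Fact p.Prime] (hp5 : 5 ≤ p) (hpC : p ≤ (Nat.log 2 n) ^ C)
    {B : ℕ} (hB : B ≤ (Nat.log 2 n) ^ C) (π : Fin n → Fin B)
    (hm : ∀ b, (Nat.log 2 n) ^ (4 * C + 6) ≤ (univ.filter fun i : Fin n => π i = b).card)
    (H : Fin (n + 1) → (Fin B → ZMod p) → Bool) :
    ((univ.filter fun u : Fin n → Bool => ringWinU c (fun g u => H g (classRes p π u)) u = true).card : ℝ) ≤ (7 / 8) * (2 : ℝ) ^ n := by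
  haveI : NeZero p := ⟨hp.out.ne_zero⟩
  have hM3 : p.Coprime 3 := (Nat.coprime_primes hp.out Nat.prime_three).2 (by omega)
  have hdist : ∀ γ : Fin B → ZMod p, γ ≠ 0 →
      (Nat.log 2 n) ^ (4 * C + 6) ≤ (univ.filter fun i : Fin n => (∑ j, γ j * (if π i = j then (1 : ZMod p) else 0)) ≠ 0).card := by
    intro γ hγ
    obtain ⟨b₀, hb₀⟩ : ∃ b, γ b ≠ 0 := Function.ne_iff.mp hγ
    refine le_trans (hm b₀) (Finset.card_le_card fun i hi => ?_)
    simp only [Finset.mem_filter, Finset.mem_univ, true_and] at hi ⊢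
    simp only [mul_ite, mul_one, mul_zero, Finset.sum_ite_eq, Finset.mem_univ, if_true]
    rw [hi]; exact hb₀
  have key := DigitDial.spreadLinM_card_win_le C hn c hM3 hpC hB (fun b i => if π i = b then (1 : ZMod p) else 0) hdist H
  have hval : ∀ u : Fin n → Bool,
      DigitDial.linVal (fun b i => if π i = b then (1 : ZMod p) else 0) u = classRes p π u := fun u => funext fun b => by
    show form (fun i => if π i = b then (1 : ZMod p) else 0) u = _
    rw [form_young, one_mul]
    rfl
  have hstrat : DigitDial.linStrat (fun b i => if π i = b then (1 : ZMod p) else 0) H = fun g u => H g (classRes p π u) := by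
    funext g u
    show H g (DigitDial.linVal _ u) = H g (classRes p π u)
    rw [hval u]
  rw [hstrat] at key
  exact key

/-- **kernel floor of the Young slice (junta-free), by name.**  Same hypotheses; every Young datum over `π` (cut `g`'s form = `l g` times
the indicator of class `β g`) whose tables ignore `u` presents a strategy winning on `≤ (7/8)·2ⁿ` inputs (the floor above through the
simulation identity `strat_eq_of_young`). -/
theorem youngForms_floor (C : ℕ) (hn : 16 ≤ n) (c : ℕ) [hp : Fact p.Prime] (hp5 : 5 ≤ p) (hpC : p ≤ (Nat.log 2 n) ^ C)
    {B : ℕ} (hB : B ≤ (Nat.log 2 n) ^ C) (π : Fin n → Fin B)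
    (hm : ∀ b, (Nat.log 2 n) ^ (4 * C + 6) ≤ (univ.filter fun i : Fin n => π i = b).card)
    (D : JLinData p n) (β : Fin (n + 1) → Fin B) (l : Fin (n + 1) → ZMod p)
    (hβl : ∀ g, D.a g = fun i => if π i = β g then l g else 0) (hfree : ∀ g (u v : Fin n → Bool) (s : ZMod p), D.h g u s = D.h g v s) :
    ((univ.filter fun u : Fin n → Bool => ringWinU c D.strat u = true).card : ℝ) ≤ (7 / 8) * (2 : ℝ) ^ n := by
  set H : Fin (n + 1) → (Fin B → ZMod p) → Bool := fun g v => D.h g (fun _ => false) (l g * v (β g)) with hH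
  have key := youngSideInfo_floor C hn c hp5 hpC hB π hm H
  have hstrat : (fun g u => H g (classRes p π u)) = D.strat := by
    rw [← strat_eq_of_young π D β l hβl]
    funext g u
    exact hfree g (fun _ => false) u _
  rw [hstrat] at key
  exact key

end Summit.QuantumAdvantage.AdviceFreeQNC0.JLinPeel.SegMove
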